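import Literature.Geometry.Lorentzian.ReggeWheelerTortoise
import Literature.Geometry.Lorentzian.ReggeWheelerChannels
import Summits.FinalStateConjecture.FinalStateConjecture.Theorems.PhotonSphereChannelsEnergyConservation

/-!
# Route PhotonSphereChannels — exterior-energy monotonicity, finite speed and energy conservation
# over the tree's Regge–Wheeler vocabulary (`Literature.Geometry.Lorentzian.ReggeWheeler*`)

The energy–flux calculus of `PhotonSphereChannelsEnergyIdentity/…Inequalities/…ExteriorEnergy/
…FiniteSpeed/…EnergyConservation` (namespace `…Theorems.WaveEnergy`) restated over the Literature
vocabulary in which the crux lines of `UniformPhotonSphereChannels` (item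
stmt-FinalStateConjecture-10045) and the items `FixedModeChannels` (stmt-…-10048),
`BlindnessInsidePhotonSphere` (stmt-…-10049) are now planned:
`ReggeWheeler.{energyDensity, IsSolution, IsRWSolution, exteriorEnergy, channelEnergy, totalEnergy,
CauchyDataSupportedOn, linePotential, IsTortoiseRadius}` — these are definitionally the inlined
`let`s of the route decls, so every proof below is `unfold` + `exact`.

* `RW.exteriorEnergy_antitoneOn` — for `V ≥ 0` DIFFERENTIABLE and a global `C²`
  solution: `exteriorEnergy V xc ρ ψ` is antitone on `t ≥ 0` and monotone on `t ≤ 0` (`ρ ≥ 0`);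
  this is the registered stub `stub_exteriorEnergy_antitone` of line `kruskal-rest-frame-virial`
  with `Continuous V` strengthened to `Differentiable ℝ V` and WITHOUT its support hypothesis —
  enough for the line's composition, which only instantiates `V = linePotential M s ℓ r`
  (differentiable: `RW.differentiable_linePotential`), see `RW.exteriorEnergy_antitoneOn_rw`;
* `RW.channelEnergy_atTop_eq_iInf`, `RW.channelEnergy_atBot_eq_iInf`, `RW.channelEnergy_add_le`,
  `RW.channelEnergy_add_le_two_mul` — the `liminf`s are infima; finite times suffice;
* `RW.eq_zero_of_cauchyDataSupportedOn` — finite speed of propagation for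
  data supported in `(a, b)`; `RW.totalEnergy_eq` — the total energy is conserved and equals
  `ofReal (∫_a^b e(0,·))` (finite), in the vocabulary of `BlindnessInsidePhotonSphere`.

Declared in `…Theorems.RW` (the Literature namespace is not written into from `Summits/`).
No new definitions. [folklore]
-/

namespace Summit.FinalStateConjecture.FinalStateConjecture.Theorems

open MeasureTheory Set Filter Topology
open Literature.Geometry.Lorentzian.ReggeWheeler

noncomputable section

namespace RW

/-! ### General differentiable potential `V ≥ 0` -/

section General

variable {V : ℝ → ℝ} {ψ : ℝ → ℝ → ℝ}

/-- The `|t|`-monotonicity of the exterior energy of a global `C²` solution (`V ≥ 0`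
differentiable, `ρ ≥ 0`): `E_ext(t₂) ≤ E_ext(t₁)` for `|t₁| ≤ |t₂|`, `t₁ t₂ ≥ 0`. [folklore] -/
theorem exteriorEnergy_mono_abs (hV : Differentiable ℝ V) (hV0 : ∀ x, 0 ≤ V x)
    (hψ : IsSolution V ψ) (xc : ℝ) {ρ : ℝ} (hρ : 0 ≤ ρ) {t₁ t₂ : ℝ} (habs : |t₁| ≤ |t₂|)
    (hsign : 0 ≤ t₁ * t₂) : exteriorEnergy V xc ρ ψ t₂ ≤ exteriorEnergy V xc ρ ψ t₁ := by
  unfold exteriorEnergy energyDensity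
  exact WaveEnergy.exteriorEnergy_mono_abs_curried hV hV0 hψ.1 (fun t x => hψ.2 (t, x)) xc hρ
    habs hsign

/-- **Exterior-energy monotonicity** (the energy–flux identity at the receding edges, integrated):
for `V ≥ 0` differentiable and a global `C²` solution, `t ↦ exteriorEnergy V xc ρ ψ t` is
non-increasing on `[0, ∞)` and non-decreasing on `(−∞, 0]` (`ρ ≥ 0`).  This is stub
`stub_exteriorEnergy_antitone` of line `kruskal-rest-frame-virial` (crux
stmt-FinalStateConjecture-10045) with `Differentiable ℝ V` in place of `Continuous V` and no support
hypothesis. [folklore] -/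
theorem exteriorEnergy_antitoneOn (hV : Differentiable ℝ V) (hV0 : ∀ x, 0 ≤ V x)
    (hψ : IsSolution V ψ) (xc : ℝ) {ρ : ℝ} (hρ : 0 ≤ ρ) :
    AntitoneOn (exteriorEnergy V xc ρ ψ) (Ici 0) ∧ MonotoneOn (exteriorEnergy V xc ρ ψ) (Iic 0) :=
  ⟨WaveEnergy.channel_antitoneOn fun _ _ h1 h2 => exteriorEnergy_mono_abs hV hV0 hψ xc hρ h1 h2,
    WaveEnergy.channel_monotoneOn fun _ _ h1 h2 => exteriorEnergy_mono_abs hV hV0 hψ xc hρ h1 h2⟩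

/-- The exterior energy is maximal at `t = 0`. [folklore] -/
theorem exteriorEnergy_le_zero_time (hV : Differentiable ℝ V) (hV0 : ∀ x, 0 ≤ V x)
    (hψ : IsSolution V ψ) (xc : ℝ) {ρ : ℝ} (hρ : 0 ≤ ρ) (t : ℝ) :
    exteriorEnergy V xc ρ ψ t ≤ exteriorEnergy V xc ρ ψ 0 :=
  WaveEnergy.channel_le_zero_time (fun _ _ h1 h2 => exteriorEnergy_mono_abs hV hV0 hψ xc hρ h1 h2) t

/-- The forward channel energy is the infimum of the exterior energies over `t ≥ 0` (and the
`liminf` is a limit). [folklore] -/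
theorem channelEnergy_atTop_eq_iInf (hV : Differentiable ℝ V) (hV0 : ∀ x, 0 ≤ V x)
    (hψ : IsSolution V ψ) (xc : ℝ) {ρ : ℝ} (hρ : 0 ≤ ρ) :
    channelEnergy V xc ρ ψ atTop = ⨅ t ∈ Ici (0 : ℝ), exteriorEnergy V xc ρ ψ t :=
  WaveEnergy.channel_liminf_atTop_eq fun _ _ h1 h2 => exteriorEnergy_mono_abs hV hV0 hψ xc hρ h1 h2

/-- The backward channel energy is the infimum of the exterior energies over `t ≤ 0`. [folklore] -/
theorem channelEnergy_atBot_eq_iInf (hV : Differentiable ℝ V) (hV0 : ∀ x, 0 ≤ V x)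
    (hψ : IsSolution V ψ) (xc : ℝ) {ρ : ℝ} (hρ : 0 ≤ ρ) :
    channelEnergy V xc ρ ψ atBot = ⨅ t ∈ Iic (0 : ℝ), exteriorEnergy V xc ρ ψ t :=
  WaveEnergy.channel_liminf_atBot_eq fun _ _ h1 h2 => exteriorEnergy_mono_abs hV hV0 hψ xc hρ h1 h2

/-- **Finite times suffice**: the two-sided channel energy is at most `E_ext(T₊) + E_ext(T₋)` for
any finite `T₋ ≤ 0 ≤ T₊`. [folklore] -/
theorem channelEnergy_add_le (hV : Differentiable ℝ V) (hV0 : ∀ x, 0 ≤ V x)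
    (hψ : IsSolution V ψ) (xc : ℝ) {ρ : ℝ} (hρ : 0 ≤ ρ) {Tp Tm : ℝ} (hTp : 0 ≤ Tp) (hTm : Tm ≤ 0) :
    channelEnergy V xc ρ ψ atTop + channelEnergy V xc ρ ψ atBot
      ≤ exteriorEnergy V xc ρ ψ Tp + exteriorEnergy V xc ρ ψ Tm :=
  WaveEnergy.channel_sum_liminf_le (fun _ _ h1 h2 => exteriorEnergy_mono_abs hV hV0 hψ xc hρ h1 h2)
    hTp hTm

/-- In particular the two-sided channel energy never exceeds twice the initial exterior energy.
[folklore] -/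
theorem channelEnergy_add_le_two_mul (hV : Differentiable ℝ V) (hV0 : ∀ x, 0 ≤ V x)
    (hψ : IsSolution V ψ) (xc : ℝ) {ρ : ℝ} (hρ : 0 ≤ ρ) :
    channelEnergy V xc ρ ψ atTop + channelEnergy V xc ρ ψ atBot ≤ 2 * exteriorEnergy V xc ρ ψ 0 :=
  WaveEnergy.channel_sum_liminf_le_two_mul fun _ _ h1 h2 =>
    exteriorEnergy_mono_abs hV hV0 hψ xc hρ h1 h2

/-- **Finite speed of propagation**: a global `C²` solution (`V ≥ 0` differentiable) whose Cauchy
data are supported in `(a, b)` vanishes for `x ≥ b + |t|` and for `x ≤ a − |t|`. [folklore] -/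
theorem eq_zero_of_cauchyDataSupportedOn (hV : Differentiable ℝ V) (hV0 : ∀ x, 0 ≤ V x)
    (hψ : IsSolution V ψ) {a b : ℝ} (hdata : CauchyDataSupportedOn ψ (Ioo a b)) {t x : ℝ}
    (hx : b + |t| ≤ x ∨ x ≤ a - |t|) : ψ t x = 0 :=
  WaveEnergy.curried_eq_zero_outside_cone hV hV0 hψ.1 (fun t x => hψ.2 (t, x))
    (cauchyDataSupportedOn_Ioo.1 hdata) hx

/-- **Energy conservation for compactly supported data**: for a global `C²` solution (`V ≥ 0`
differentiable) with Cauchy data supported in `(a, b)`, `a ≤ b`, the total energy at every time is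
`ofReal (∫_a^b e(0, ·))`; in particular it is finite and constant in `t`. [folklore] -/
theorem totalEnergy_eq (hV : Differentiable ℝ V) (hV0 : ∀ x, 0 ≤ V x) (hψ : IsSolution V ψ)
    {a b : ℝ} (hab : a ≤ b) (hdata : CauchyDataSupportedOn ψ (Ioo a b)) (t : ℝ) :
    totalEnergy V ψ t = ENNReal.ofReal (∫ x in a..b, energyDensity V ψ 0 x) := by
  unfold totalEnergy energyDensity
  exact WaveEnergy.curried_lintegral_energy_eq_initial hV hV0 hψ.1 (fun t x => hψ.2 (t, x)) hab
    (cauchyDataSupportedOn_Ioo.1 hdata) t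

/-- The total energy of compactly supported data is conserved. [folklore] -/
theorem totalEnergy_eq_totalEnergy_zero (hV : Differentiable ℝ V) (hV0 : ∀ x, 0 ≤ V x)
    (hψ : IsSolution V ψ) {a b : ℝ} (hab : a ≤ b) (hdata : CauchyDataSupportedOn ψ (Ioo a b))
    (t : ℝ) : totalEnergy V ψ t = totalEnergy V ψ 0 := by
  rw [totalEnergy_eq hV hV0 hψ hab hdata t, totalEnergy_eq hV hV0 hψ hab hdata 0]

/-- The total energy of compactly supported data is finite. [folklore] -/
theorem totalEnergy_lt_top (hV : Differentiable ℝ V) (hV0 : ∀ x, 0 ≤ V x) (hψ : IsSolution V ψ)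
    {a b : ℝ} (hab : a ≤ b) (hdata : CauchyDataSupportedOn ψ (Ioo a b)) (t : ℝ) :
    totalEnergy V ψ t < ⊤ := by
  rw [totalEnergy_eq hV hV0 hψ hab hdata t]
  exact ENNReal.ofReal_lt_top

end General

/-! ### The Regge–Wheeler potential along a tortoise radius function -/

section Tortoise

variable {M : ℝ} {r : ℝ → ℝ} {xc : ℝ}

/-- The Regge–Wheeler line potential along a tortoise radius function is differentiable.
[folklore] -/
theorem differentiable_linePotential (hr : IsTortoiseRadius M r xc) (s ℓ : ℕ) :
    Differentiable ℝ (linePotential M s ℓ r) :=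
  WaveEnergy.differentiable_reggeWheeler hr.two_mul_lt hr.mass_pos hr.hasDerivAt s ℓ

/-- The Regge–Wheeler line potential along a tortoise radius function is positive for `s ≤ ℓ`.
[folklore] -/
theorem linePotential_pos (hr : IsTortoiseRadius M r xc) {s ℓ : ℕ} (hsℓ : s ≤ ℓ) (x : ℝ) :
    0 < linePotential M s ℓ r x :=
  WaveEnergy.reggeWheeler_pos hr.two_mul_lt hr.mass_pos hsℓ x

end Tortoise

section ReggeWheelerInstance

variable {M : ℝ} {r : ℝ → ℝ} {xc : ℝ} {s ℓ : ℕ} {ψ : ℝ → ℝ → ℝ}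

/-- **Exterior-energy monotonicity for Regge–Wheeler solutions**: for a tortoise radius function,
`s ≤ ℓ`, a global `C²` solution of `ψ_tt − ψ_xx + V_{s,ℓ}(r(x))ψ = 0` and any centre `xc'` and
aperture `ρ ≥ 0`, `exteriorEnergy (linePotential M s ℓ r) xc' ρ ψ` is antitone on `t ≥ 0` and
monotone on `t ≤ 0` — the instance of stub `stub_exteriorEnergy_antitone` that the composition of
line `kruskal-rest-frame-virial` uses. [folklore] -/
theorem exteriorEnergy_antitoneOn_rw (hr : IsTortoiseRadius M r xc) (hsℓ : s ≤ ℓ)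
    (hψ : IsRWSolution M s ℓ r ψ) (xc' : ℝ) {ρ : ℝ} (hρ : 0 ≤ ρ) :
    AntitoneOn (exteriorEnergy (linePotential M s ℓ r) xc' ρ ψ) (Ici 0) ∧
      MonotoneOn (exteriorEnergy (linePotential M s ℓ r) xc' ρ ψ) (Iic 0) :=
  exteriorEnergy_antitoneOn (differentiable_linePotential hr s ℓ)
    (fun x => (linePotential_pos hr hsℓ x).le) hψ xc' hρ

/-- `|t|`-monotonicity for Regge–Wheeler solutions. [folklore] -/
theorem exteriorEnergy_mono_abs_rw (hr : IsTortoiseRadius M r xc) (hsℓ : s ≤ ℓ)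
    (hψ : IsRWSolution M s ℓ r ψ) (xc' : ℝ) {ρ : ℝ} (hρ : 0 ≤ ρ) {t₁ t₂ : ℝ} (habs : |t₁| ≤ |t₂|)
    (hsign : 0 ≤ t₁ * t₂) :
    exteriorEnergy (linePotential M s ℓ r) xc' ρ ψ t₂ ≤ exteriorEnergy (linePotential M s ℓ r) xc' ρ ψ t₁ :=
  exteriorEnergy_mono_abs (differentiable_linePotential hr s ℓ)
    (fun x => (linePotential_pos hr hsℓ x).le) hψ xc' hρ habs hsign

/-- Finite times suffice, Regge–Wheeler instance. [folklore] -/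
theorem channelEnergy_add_le_rw (hr : IsTortoiseRadius M r xc) (hsℓ : s ≤ ℓ)
    (hψ : IsRWSolution M s ℓ r ψ) (xc' : ℝ) {ρ : ℝ} (hρ : 0 ≤ ρ) {Tp Tm : ℝ} (hTp : 0 ≤ Tp)
    (hTm : Tm ≤ 0) :
    channelEnergy (linePotential M s ℓ r) xc' ρ ψ atTop + channelEnergy (linePotential M s ℓ r) xc' ρ ψ atBot
      ≤ exteriorEnergy (linePotential M s ℓ r) xc' ρ ψ Tp + exteriorEnergy (linePotential M s ℓ r) xc' ρ ψ Tm :=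
  channelEnergy_add_le (differentiable_linePotential hr s ℓ)
    (fun x => (linePotential_pos hr hsℓ x).le) hψ xc' hρ hTp hTm

/-- Finite speed of propagation, Regge–Wheeler instance (the support conclusion of stub
`stub_rwCauchy`): data supported in `(a, b)` ⇒ `ψ t x = 0` whenever `x + |t| ≤ a` or
`b + |t| ≤ x`. [folklore] -/
theorem eq_zero_of_cauchyDataSupportedOn_rw (hr : IsTortoiseRadius M r xc) (hsℓ : s ≤ ℓ)
    (hψ : IsRWSolution M s ℓ r ψ) {a b : ℝ} (hdata : CauchyDataSupportedOn ψ (Ioo a b)) {t x : ℝ}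
    (hx : x + |t| ≤ a ∨ b + |t| ≤ x) : ψ t x = 0 :=
  eq_zero_of_cauchyDataSupportedOn (differentiable_linePotential hr s ℓ)
    (fun x => (linePotential_pos hr hsℓ x).le) hψ hdata
    (hx.symm.imp id fun h => by linarith)

/-- Conservation and finiteness of the total energy, Regge–Wheeler instance. [folklore] -/
theorem totalEnergy_eq_rw (hr : IsTortoiseRadius M r xc) (hsℓ : s ≤ ℓ) (hψ : IsRWSolution M s ℓ r ψ)
    {a b : ℝ} (hab : a ≤ b) (hdata : CauchyDataSupportedOn ψ (Ioo a b)) (t : ℝ) :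
    totalEnergy (linePotential M s ℓ r) ψ t
      = ENNReal.ofReal (∫ x in a..b, energyDensity (linePotential M s ℓ r) ψ 0 x) :=
  totalEnergy_eq (differentiable_linePotential hr s ℓ)
    (fun x => (linePotential_pos hr hsℓ x).le) hψ hab hdata t

end ReggeWheelerInstance

end RW

end

end Summit.FinalStateConjecture.FinalStateConjecture.Theorems
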